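import Mathlib
import Literature.Analysis.FluidPDE.Tao2016AveragedNS.BoundedEternalSolutions
import Summits.NavierStokesRegularity.NavierStokesRegularity.Theorems.WakeRatchetAdmissibleEternalBoundOrthant
import HarnessLib

/-!
# `WakeRatchet.TailRatchet` (stmt-NavierStokesRegularity-21808) — hypothesis class of the tail ratchets:
# an eternal solution that is QUIET ON A PAST HALF-LINE is identically zero (backward amplitude floor)

Support file (route `WakeRatchet`; MODEL lattice ODEs of Tao 2016 §4 in the renormalised variables of §6.4 —
nothing here is a statement about the Navier–Stokes equations; no item is closed).

All four tail ratchets (stmt-21808 / 25584 / 25646 / 25647) and the Liouville rungs of the Tao ladder quantify over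
eternal solutions `W` of the renormalised lattice of a table `α` (`IsEternalVisc ε₀ ν̂ α W`, any covariant viscosity
`ν̂ ≥ 0`).  The object that would refute stmt-21808 is a non-trivial such solution at arbitrarily small `ε₀`
(tree: `Negative/TailRatchetFalseOfPersistentDSSWaves`, `WakeRatchetAllExponents.not_tailRatchet_of_surviving`), and
every soft construction of such objects (α-limits of viscous eternal solutions, frames of blow-ups) needs a
NON-DEGENERACY statement in the far past.  This file proves the elementary one, for ANY table (no cancellation is
used) and ANY `ν̂ ≥ 0`, from the law alone:

* `weighted_sq_le` — on a window `[a, b]` on which all shells are bounded by `D`, every shell obeys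
  `e^{2u}‖W_n(u)‖² ≤ e^{2a}‖W_n(a)‖² + K D³ (e^{2u} − e^{2a})`, where `K` bounds the table constant
  `C_Q + Λ C_A + Λ⁻¹ C_B` (`shiftConst`): the unit damping is absorbed by the weight `e^{2u}`, the viscous term helps;
* `sq_le_of_quiet_past` — hence if `‖W_m(σ)‖ ≤ δ` for all shells and all `σ ≤ σ₁`, then `‖W_n(σ)‖² ≤ K δ³` there
  (let `a → −∞`): a quiet past is SELF-IMPROVING as soon as `K δ < 1`;
* `eq_zero_on_quiet_past` — iterating (`δ ↦ δ/2` while `K δ ≤ 1/4`): a solution with `‖W_n(σ)‖ ≤ δ` for all `n` and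
  all `σ ≤ σ₁`, `K δ ≤ 1/4`, vanishes identically on `σ ≤ σ₁`;
* the companion file `WakeRatchetTailRatchetQuietPastFloor` adds forward uniqueness from a zero time-slice and the
  **backward amplitude floor** `past_loud`: a non-trivial uniformly bounded eternal solution has, for every `σ₁`, a log-time
  `σ ≤ σ₁` and a shell `n` with `‖W_n(σ)‖ > 1/(4K)`.

Compare the tree's GLOBAL floor `WakeRatchetEternalFloor` (`sup_{n,σ} ‖W‖ > 1/(896 ε₀)`, from cancellation and the
action clause): the present floor is smaller (`O(1)` in `ε₀`) but LOCALISED IN THE PAST, which is what α-limit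
extractions consume.

HONEST FRAMING: elementary real analysis for a MODEL lattice ODE; stmt-21808 is neither proved nor refuted here (it stays
dead modulo the construction `WakeRatchetDyadicFront.DyadicScalarFronts`).
-/

noncomputable section

set_option linter.dupNamespace false

namespace Summit.NavierStokesRegularity.NavierStokesRegularity.Theorems

namespace WakeRatchetQuietPast

open Set Filter Topology
open scoped RealInnerProductSpace
open Literature.Analysis.FluidPDE Literature.Analysis.FluidPDE.TaoCascade

variable {m : ℕ} {ε₀ νh : ℝ} {α : Fin m → Fin m → Fin m → ℤ × ℤ × ℤ → ℝ} {W : ℤ → ℝ → Em m}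

/-! ## The quadratic part of the law and its norm bound -/

/-- Norm bound for the quadratic part of the renormalised law at one shell:
`‖Q(x) + Λ A(y) + Λ⁻¹ B(z, x)‖ ≤ C_Q ‖x‖² + Λ C_A ‖y‖² + Λ⁻¹ C_B ‖z‖ ‖x‖` (tree: `norm_tableQ_le`, `norm_tableA_le`,
`norm_tableB_le`).
[cite: Tao2016AveragedNS, §4 (4.1), Lemma 4.1 (4.8); cell lemma] -/
theorem norm_quad_le (hε : -1 < ε₀) (x y z : Em m) :
    ‖tableQ α x + bigLam ε₀ • tableA α y + (bigLam ε₀)⁻¹ • tableB α z x‖ ≤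
      shiftConst α (0, 0, 0) * ‖x‖ ^ 2 + bigLam ε₀ * (shiftConst α (0, 0, 1) * ‖y‖ ^ 2)
        + (bigLam ε₀)⁻¹ * ((shiftConst α (1, 0, 0) + shiftConst α (0, 1, 0)) * ‖z‖ * ‖x‖) := by
  have hL : 0 < bigLam ε₀ := bigLam_pos hε
  calc ‖tableQ α x + bigLam ε₀ • tableA α y + (bigLam ε₀)⁻¹ • tableB α z x‖
      ≤ ‖tableQ α x‖ + ‖bigLam ε₀ • tableA α y‖ + ‖(bigLam ε₀)⁻¹ • tableB α z x‖ :=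
        (norm_add_le _ _).trans (add_le_add (norm_add_le _ _) le_rfl)
    _ ≤ _ := by
        rw [norm_smul, norm_smul, Real.norm_of_nonneg hL.le, Real.norm_of_nonneg (inv_nonneg.2 hL.le)]
        exact add_le_add (add_le_add (norm_tableQ_le α x)
          (mul_le_mul_of_nonneg_left (norm_tableA_le α y) hL.le))
          (mul_le_mul_of_nonneg_left (norm_tableB_le α z x) (inv_nonneg.2 hL.le))

/-- The table constant `C_Q + Λ C_A + Λ⁻¹ C_B` is non-negative, so every upper bound `K` of it is.
[cite: Tao2016AveragedNS, §4 (4.1); cell lemma] -/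
theorem tableConst_nonneg (hε : -1 < ε₀) {K : ℝ}
    (hK : shiftConst α (0, 0, 0) + bigLam ε₀ * shiftConst α (0, 0, 1)
      + (bigLam ε₀)⁻¹ * (shiftConst α (1, 0, 0) + shiftConst α (0, 1, 0)) ≤ K) : 0 ≤ K := by
  have hL : 0 < bigLam ε₀ := bigLam_pos hε
  have h0 := shiftConst_nonneg α (0, 0, 0)
  have h1 := shiftConst_nonneg α (0, 0, 1)
  have h2 := shiftConst_nonneg α (1, 0, 0)
  have h3 := shiftConst_nonneg α (0, 1, 0)
  have : 0 ≤ shiftConst α (0, 0, 0) + bigLam ε₀ * shiftConst α (0, 0, 1)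
      + (bigLam ε₀)⁻¹ * (shiftConst α (1, 0, 0) + shiftConst α (0, 1, 0)) := by positivity
  linarith

/-- If three shell vectors are bounded by `D ≥ 0` and `K` bounds `C_Q + Λ C_A + Λ⁻¹ C_B`, the quadratic part of the
law is at most `K D²` in norm. [cite: Tao2016AveragedNS, §4 (4.1), Lemma 4.1 (4.8); cell lemma] -/
theorem norm_quad_le_of_bound (hε : -1 < ε₀) {K D : ℝ}
    (hK : shiftConst α (0, 0, 0) + bigLam ε₀ * shiftConst α (0, 0, 1)
      + (bigLam ε₀)⁻¹ * (shiftConst α (1, 0, 0) + shiftConst α (0, 1, 0)) ≤ K)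
    (hD : 0 ≤ D) {x y z : Em m} (hx : ‖x‖ ≤ D) (hy : ‖y‖ ≤ D) (hz : ‖z‖ ≤ D) :
    ‖tableQ α x + bigLam ε₀ • tableA α y + (bigLam ε₀)⁻¹ • tableB α z x‖ ≤ K * D ^ 2 := by
  have hL : 0 < bigLam ε₀ := bigLam_pos hε
  have h0 := shiftConst_nonneg α (0, 0, 0)
  have h1 := shiftConst_nonneg α (0, 0, 1)
  have h2 := shiftConst_nonneg α (1, 0, 0)
  have h3 := shiftConst_nonneg α (0, 1, 0)
  have hx2 : ‖x‖ ^ 2 ≤ D ^ 2 := pow_le_pow_left₀ (norm_nonneg _) hx 2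
  have hy2 : ‖y‖ ^ 2 ≤ D ^ 2 := pow_le_pow_left₀ (norm_nonneg _) hy 2
  have hzx : ‖z‖ * ‖x‖ ≤ D ^ 2 := by
    rw [sq]; exact mul_le_mul hz hx (norm_nonneg _) hD
  refine (norm_quad_le hε x y z).trans ?_
  have hA : shiftConst α (0, 0, 0) * ‖x‖ ^ 2 ≤ shiftConst α (0, 0, 0) * D ^ 2 :=
    mul_le_mul_of_nonneg_left hx2 h0
  have hB : bigLam ε₀ * (shiftConst α (0, 0, 1) * ‖y‖ ^ 2) ≤
      bigLam ε₀ * (shiftConst α (0, 0, 1) * D ^ 2) :=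
    mul_le_mul_of_nonneg_left (mul_le_mul_of_nonneg_left hy2 h1) hL.le
  have hC : (bigLam ε₀)⁻¹ * ((shiftConst α (1, 0, 0) + shiftConst α (0, 1, 0)) * ‖z‖ * ‖x‖) ≤
      (bigLam ε₀)⁻¹ * ((shiftConst α (1, 0, 0) + shiftConst α (0, 1, 0)) * D ^ 2) := by
    refine mul_le_mul_of_nonneg_left ?_ (inv_nonneg.2 hL.le)
    rw [mul_assoc]
    exact mul_le_mul_of_nonneg_left hzx (by linarith)
  have hsum : shiftConst α (0, 0, 0) * D ^ 2 + bigLam ε₀ * (shiftConst α (0, 0, 1) * D ^ 2)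
      + (bigLam ε₀)⁻¹ * ((shiftConst α (1, 0, 0) + shiftConst α (0, 1, 0)) * D ^ 2)
      = (shiftConst α (0, 0, 0) + bigLam ε₀ * shiftConst α (0, 0, 1)
          + (bigLam ε₀)⁻¹ * (shiftConst α (1, 0, 0) + shiftConst α (0, 1, 0))) * D ^ 2 := by ring
  calc _ ≤ shiftConst α (0, 0, 0) * D ^ 2 + bigLam ε₀ * (shiftConst α (0, 0, 1) * D ^ 2)
        + (bigLam ε₀)⁻¹ * ((shiftConst α (1, 0, 0) + shiftConst α (0, 1, 0)) * D ^ 2) :=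
        add_le_add (add_le_add hA hB) hC
    _ = _ := hsum
    _ ≤ K * D ^ 2 := mul_le_mul_of_nonneg_right hK (sq_nonneg D)

/-! ## The weighted single-shell energy `e^{2u} ‖W_n(u)‖²` -/

/-- **Derivative of the weighted shell energy along the law.**  With `N_n = Q(W_n) + Λ A(W_{n-1}) + Λ⁻¹ B(W_{n+1}, W_n)`
and viscous coefficient `v = ν̂ (1+ε₀)^{2n} e^{-u} ≥ 0`, the weighted energy `e^{2u}‖W_n(u)‖²` is differentiable with
derivative `2 e^{2u} (⟨W_n, N_n⟩ − v ‖W_n‖²) ≤ 2 e^{2u} ‖W_n‖ ‖N_n‖` — the unit damping is exactly absorbed by the weight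
and the viscous term has the good sign. [cite: Tao2016AveragedNS, §4 Lemma 4.1 (4.8)–(4.10) in the variables of §6.4; cell lemma] -/
theorem hasDerivAt_weighted_sq (hε : -1 < ε₀) (hW : IsEternalVisc ε₀ νh α W) (n : ℤ) (u : ℝ) :
    ∃ d : ℝ, HasDerivAt (fun y => Real.exp (2 * y) * ‖W n y‖ ^ 2) d u ∧
      d ≤ 2 * Real.exp (2 * u) * (‖W n u‖ *
        ‖tableQ α (W n u) + bigLam ε₀ • tableA α (W (n - 1) u)
          + (bigLam ε₀)⁻¹ • tableB α (W (n + 1) u) (W n u)‖) := by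
  have hlaw := hW.law n u
  set N : Em m := tableQ α (W n u) + bigLam ε₀ • tableA α (W (n - 1) u)
    + (bigLam ε₀)⁻¹ • tableB α (W (n + 1) u) (W n u) with hN
  set v : ℝ := νh * ((1 + ε₀) ^ ((2 : ℝ) * n) * Real.exp (-u)) with hv
  -- the derivative given by the law is `N − (1 + v) • W n u`
  have hderiv_eq : -((1 : ℝ) • W n u) + tableQ α (W n u) + bigLam ε₀ • tableA α (W (n - 1) u)
      + (bigLam ε₀)⁻¹ • tableB α (W (n + 1) u) (W n u) - v • W n u = N - (1 + v) • W n u := by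
    rw [hN, add_smul, one_smul]; abel
  have hlaw' : HasDerivAt (W n) (N - (1 + v) • W n u) u := hlaw.congr_deriv hderiv_eq
  have h1 : HasDerivAt (fun y : ℝ => Real.exp (2 * y)) (Real.exp (2 * u) * 2) u := by
    have h := ((hasDerivAt_id u).const_mul (2 : ℝ)).exp
    simpa using h
  have h2 := hlaw'.norm_sq
  refine ⟨_, h1.mul h2, ?_⟩
  have hinner : ⟪W n u, N - (1 + v) • W n u⟫ = ⟪W n u, N⟫ - (1 + v) * ‖W n u‖ ^ 2 := by
    rw [inner_sub_right, inner_smul_right, real_inner_self_eq_norm_sq]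
  have hv0 : 0 ≤ v := by
    rw [hv]
    have hb : 0 < (1 + ε₀) ^ ((2 : ℝ) * n) := Real.rpow_pos_of_pos (by linarith) _
    exact mul_nonneg hW.nonneg (mul_nonneg hb.le (Real.exp_pos _).le)
  have hWN : ⟪W n u, N⟫ ≤ ‖W n u‖ * ‖N‖ := real_inner_le_norm _ _
  have hexp : 0 < Real.exp (2 * u) := Real.exp_pos _
  have hvW : 0 ≤ v * ‖W n u‖ ^ 2 := mul_nonneg hv0 (sq_nonneg _)
  have hA := mul_le_mul_of_nonneg_left hWN hexp.le
  have hB := mul_nonneg hexp.le hvW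
  rw [hinner]
  nlinarith [hA, hB, sq_nonneg ‖W n u‖, hexp]

/-- **Window estimate.**  If on the log-time window `[a, b]` every shell is bounded by `D ≥ 0`, then every shell `n`
obeys `e^{2u}‖W_n(u)‖² ≤ e^{2a}‖W_n(a)‖² + K D³ (e^{2u} − e^{2a})` for `u ∈ [a, b]` (`K` any bound of the table
constant).  Proof: `u ↦ e^{2u}‖W_n(u)‖² − K D³ e^{2u}` is non-increasing on the window.
[cite: Tao2016AveragedNS, §4 Lemma 4.1 (4.8)–(4.10); cell lemma] -/
theorem weighted_sq_le (hε : -1 < ε₀) (hW : IsEternalVisc ε₀ νh α W) {K D a b : ℝ}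
    (hK : shiftConst α (0, 0, 0) + bigLam ε₀ * shiftConst α (0, 0, 1)
      + (bigLam ε₀)⁻¹ * (shiftConst α (1, 0, 0) + shiftConst α (0, 1, 0)) ≤ K)
    (hD : 0 ≤ D) (hbd : ∀ (k : ℤ) (u : ℝ), u ∈ Icc a b → ‖W k u‖ ≤ D) (n : ℤ) :
    ∀ u ∈ Icc a b, Real.exp (2 * u) * ‖W n u‖ ^ 2 ≤
      Real.exp (2 * a) * ‖W n a‖ ^ 2 + K * D ^ 3 * (Real.exp (2 * u) - Real.exp (2 * a)) := by
  intro u hu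
  have hab : a ≤ b := hu.1.trans hu.2
  -- the auxiliary non-increasing function
  set g : ℝ → ℝ := fun y => Real.exp (2 * y) * ‖W n y‖ ^ 2 - K * D ^ 3 * Real.exp (2 * y) with hg
  have hgc : Continuous g := by
    have hc := WakeRatchetOrthant.continuous_shell hW n
    have he : Continuous fun y : ℝ => Real.exp (2 * y) :=
      Real.continuous_exp.comp (continuous_const.mul continuous_id)
    exact (he.mul (hc.norm.pow 2)).sub (continuous_const.mul he)
  -- derivative of `g` in the interior and its sign
  have hder : ∀ x ∈ interior (Icc a b), HasDerivWithinAt g (deriv g x) (interior (Icc a b)) x ∧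
      deriv g x ≤ 0 := by
    intro x hx
    rw [interior_Icc] at hx
    have hxI : x ∈ Icc a b := Ioo_subset_Icc_self hx
    obtain ⟨d, hd, hdle⟩ := hasDerivAt_weighted_sq hε hW n x
    have he : HasDerivAt (fun y : ℝ => Real.exp (2 * y)) (Real.exp (2 * x) * 2) x := by
      have h := ((hasDerivAt_id x).const_mul (2 : ℝ)).exp
      simpa using h
    have hgx : HasDerivAt g (d - K * D ^ 3 * (Real.exp (2 * x) * 2)) x :=
      hd.sub (he.const_mul (K * D ^ 3))
    have hN : ‖tableQ α (W n x) + bigLam ε₀ • tableA α (W (n - 1) x)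
        + (bigLam ε₀)⁻¹ • tableB α (W (n + 1) x) (W n x)‖ ≤ K * D ^ 2 :=
      norm_quad_le_of_bound hε hK hD (hbd n x hxI) (hbd (n - 1) x hxI) (hbd (n + 1) x hxI)
    have hWx : ‖W n x‖ ≤ D := hbd n x hxI
    have hexp : 0 < Real.exp (2 * x) := Real.exp_pos _
    have hprod : ‖W n x‖ * ‖tableQ α (W n x) + bigLam ε₀ • tableA α (W (n - 1) x)
        + (bigLam ε₀)⁻¹ • tableB α (W (n + 1) x) (W n x)‖ ≤ D * (K * D ^ 2) :=
      mul_le_mul hWx hN (norm_nonneg _) hD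
    have hsign : d - K * D ^ 3 * (Real.exp (2 * x) * 2) ≤ 0 := by
      have := mul_le_mul_of_nonneg_left hprod (by positivity : (0 : ℝ) ≤ 2 * Real.exp (2 * x))
      nlinarith [hdle, this]
    rw [interior_Icc, hgx.deriv]
    exact ⟨hgx.hasDerivWithinAt, hsign⟩
  have hanti : AntitoneOn g (Icc a b) :=
    antitoneOn_of_hasDerivWithinAt_nonpos (convex_Icc a b) hgc.continuousOn
      (fun x hx => (hder x hx).1) (fun x hx => (hder x hx).2)
  have hga := hanti (left_mem_Icc.2 hab) hu hu.1
  simp only [hg] at hga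
  linarith

/-! ## A quiet past is self-improving, hence trivial -/

/-- **Self-improvement of a quiet past.**  If every shell satisfies `‖W_k(σ)‖ ≤ δ` for all `σ ≤ σ₁` (`δ ≥ 0`), then in
fact `‖W_n(σ)‖² ≤ K δ³` for all `n` and `σ ≤ σ₁` (window estimate on `[a, σ₁]`, then `a → −∞`).
[cite: Tao2016AveragedNS, §4 Lemma 4.1 (4.8)–(4.10); cell lemma] -/
theorem sq_le_of_quiet_past (hε : -1 < ε₀) (hW : IsEternalVisc ε₀ νh α W) {K δ σ₁ : ℝ}
    (hK : shiftConst α (0, 0, 0) + bigLam ε₀ * shiftConst α (0, 0, 1)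
      + (bigLam ε₀)⁻¹ * (shiftConst α (1, 0, 0) + shiftConst α (0, 1, 0)) ≤ K)
    (hδ : 0 ≤ δ) (hq : ∀ (k : ℤ) (σ : ℝ), σ ≤ σ₁ → ‖W k σ‖ ≤ δ) :
    ∀ (n : ℤ) (σ : ℝ), σ ≤ σ₁ → ‖W n σ‖ ^ 2 ≤ K * δ ^ 3 := by
  intro n σ hσ
  have hK0 : 0 ≤ K := tableConst_nonneg hε hK
  -- for every `a ≤ σ`: `‖W n σ‖² ≤ K δ³ + δ² e^{2a} / e^{2σ}`
  have hmain : ∀ a : ℝ, a ≤ σ →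
      ‖W n σ‖ ^ 2 ≤ K * δ ^ 3 + δ ^ 2 * Real.exp (2 * a) / Real.exp (2 * σ) := by
    intro a ha
    have hwin := weighted_sq_le hε hW hK hδ
      (fun k u hu => hq k u (hu.2.trans hσ)) n σ ⟨ha, le_rfl⟩
    have hexpσ : 0 < Real.exp (2 * σ) := Real.exp_pos _
    have hexpa : 0 < Real.exp (2 * a) := Real.exp_pos _
    have hWa : ‖W n a‖ ^ 2 ≤ δ ^ 2 := pow_le_pow_left₀ (norm_nonneg _) (hq n a (ha.trans hσ)) 2
    have h1 : Real.exp (2 * a) * ‖W n a‖ ^ 2 ≤ Real.exp (2 * a) * δ ^ 2 :=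
      mul_le_mul_of_nonneg_left hWa hexpa.le
    have h2 : 0 ≤ K * δ ^ 3 * Real.exp (2 * a) := by positivity
    have h3 : Real.exp (2 * σ) * ‖W n σ‖ ^ 2 ≤ δ ^ 2 * Real.exp (2 * a) + K * δ ^ 3 * Real.exp (2 * σ) := by
      nlinarith [hwin, h1, h2]
    have h4 : ‖W n σ‖ ^ 2 * Real.exp (2 * σ) ≤
        (K * δ ^ 3 + δ ^ 2 * Real.exp (2 * a) / Real.exp (2 * σ)) * Real.exp (2 * σ) := by
      rw [add_mul, div_mul_cancel₀ _ hexpσ.ne']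
      nlinarith [h3]
    exact le_of_mul_le_mul_right h4 hexpσ
  -- let `a → −∞`
  have hlim : Tendsto (fun a : ℝ => K * δ ^ 3 + δ ^ 2 * Real.exp (2 * a) / Real.exp (2 * σ)) atBot
      (𝓝 (K * δ ^ 3 + δ ^ 2 * 0 / Real.exp (2 * σ))) := by
    have h2a : Tendsto (fun a : ℝ => 2 * a) atBot atBot :=
      tendsto_id.const_mul_atBot (by norm_num : (0 : ℝ) < 2)
    have hexp : Tendsto (fun a : ℝ => Real.exp (2 * a)) atBot (𝓝 0) :=
      Real.tendsto_exp_atBot.comp h2a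
    exact tendsto_const_nhds.add ((hexp.const_mul _).div_const _)
  rw [mul_zero, zero_div, add_zero] at hlim
  exact ge_of_tendsto hlim (eventually_atBot.2 ⟨σ, fun a ha => hmain a ha⟩)

/-- From `x² ≤ (d/2)²`-type information: if `0 ≤ x`, `0 ≤ d` and `x² ≤ (1/4) d²` then `x ≤ d/2`. [folklore] -/
theorem le_half_of_sq_le {x d : ℝ} (hx : 0 ≤ x) (hd : 0 ≤ d) (h : x ^ 2 ≤ 1 / 4 * d ^ 2) : x ≤ d / 2 := by
  have h' : x ^ 2 ≤ (d / 2) ^ 2 := by nlinarith [h]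
  exact (pow_le_pow_iff_left₀ hx (by positivity) two_ne_zero).1 h'

/-- **A quiet past is trivial.**  If `‖W_k(σ)‖ ≤ δ` for every shell `k` and every `σ ≤ σ₁`, with `K δ ≤ 1/4` (`K` a
bound of the table constant `C_Q + Λ C_A + Λ⁻¹ C_B`), then `W_n(σ) = 0` for all `n` and all `σ ≤ σ₁`
(self-improvement halves the bound at each step: `K(δ/2^j)³ ≤ ¼ (δ/2^j)²`).
[cite: Tao2016AveragedNS, §4 Lemma 4.1 (4.8)–(4.10); cell theorem] -/
theorem eq_zero_on_quiet_past (hε : -1 < ε₀) (hW : IsEternalVisc ε₀ νh α W) {K δ σ₁ : ℝ}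
    (hK : shiftConst α (0, 0, 0) + bigLam ε₀ * shiftConst α (0, 0, 1)
      + (bigLam ε₀)⁻¹ * (shiftConst α (1, 0, 0) + shiftConst α (0, 1, 0)) ≤ K)
    (hδ : 0 ≤ δ) (hKδ : K * δ ≤ 1 / 4) (hq : ∀ (k : ℤ) (σ : ℝ), σ ≤ σ₁ → ‖W k σ‖ ≤ δ) :
    ∀ (n : ℤ) (σ : ℝ), σ ≤ σ₁ → W n σ = 0 := by
  have hK0 : 0 ≤ K := tableConst_nonneg hε hK
  -- the halving induction
  have hP : ∀ j : ℕ, ∀ (k : ℤ) (σ : ℝ), σ ≤ σ₁ → ‖W k σ‖ ≤ δ / 2 ^ j := by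
    intro j
    induction j with
    | zero => simpa using hq
    | succ j ih =>
      intro k σ hσ
      have hd : 0 ≤ δ / 2 ^ j := by positivity
      have hdle : δ / 2 ^ j ≤ δ := div_le_self hδ (one_le_pow₀ (by norm_num))
      have hsq := sq_le_of_quiet_past hε hW hK hd ih k σ hσ
      have hKd : K * (δ / 2 ^ j) ≤ 1 / 4 := (mul_le_mul_of_nonneg_left hdle hK0).trans hKδ
      have h4 : ‖W k σ‖ ^ 2 ≤ 1 / 4 * (δ / 2 ^ j) ^ 2 := by
        have : K * (δ / 2 ^ j) ^ 3 = K * (δ / 2 ^ j) * (δ / 2 ^ j) ^ 2 := by ring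
        rw [this] at hsq
        exact hsq.trans (mul_le_mul_of_nonneg_right hKd (sq_nonneg _))
      have := le_half_of_sq_le (norm_nonneg _) hd h4
      rw [pow_succ, ← div_div]
      exact this
  intro n σ hσ
  by_contra hne
  have hpos : 0 < ‖W n σ‖ := norm_pos_iff.2 hne
  obtain ⟨j, hj⟩ := pow_unbounded_of_one_lt (δ / ‖W n σ‖) (by norm_num : (1 : ℝ) < 2)
  have h1 := hP j n σ hσ
  have h2 : δ / 2 ^ j < ‖W n σ‖ := by
    rw [div_lt_iff₀ (by positivity)]
    rw [div_lt_iff₀ hpos] at hj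
    linarith [hj]
  linarith

end WakeRatchetQuietPast

end Summit.NavierStokesRegularity.NavierStokesRegularity.Theorems

end
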